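/-
Copyright: the b2b-balaban T⁴-continuum CRUX team, row NE7b OWNER lineage `t4-ne7b-p1` (gen 129). Project licence.
-/
import Summits.QuantumFields.BalabanUV.T4Continuum.Spine.NE7b.SupEffectiveActionDerivative
import Summits.QuantumFields.BalabanUV.T4Continuum.Spine.NE7b.SupOneSitePerturbation

/-!
# THE UPPER SECOND-ORDER LETTER IS INHERITED BY THE STEP WITH THE SAME CONSTANT: if every remainder obeys
# `w_x(b) ≤ w_x(a) + w'_x(a)(b−a) + ½Λ_w(b−a)²`, then at EVERY pair of external fields
#   `−log Z(ψ') ≤ −log Z(ψ) + D(−log Z)(ψ)(ψ'−ψ) + ½Λ_w·Σ_{x∈⋃cells}(ψ'_x−ψ_x)²`,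
# `Z(ψ) = ∫e^{−Σ_{p∈C}Σ_{x∈cell p}w_x(ω_x+ψ_x)}dN(0,Γ)` — Jensen for the tilted law (`−log⟨e^{−G}⟩ ≤ ⟨G⟩`, (314)'s Gibbs inequality) and
# (313)'s identification of the gradient with the tilted mean of `Σw'_x(ω_x+ψ_x)dψ_x`: the next potential's upper curvature does NOT grow —
# one half of the re-entry of `−log Z_ψ` into the road's class, with NO smallness used (row NE7b, node U5c; (313) + (314) BY NAME; [folklore])

Cell `pub-balaban`, sub-cell `t4`, spine estimate NE7b (`T4WeightBudget.RelWeightBound`; the cell's OWN estimate — NOT PRINTED in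
[Bałaban 1983–89], NOT PROVED).  Crux-route work under `Spine/NE7b/` by the row OWNER (`t4-ne7b-p1` gen 129, file (316)) under FREEZE
(0)'s crux-prover clause, on § [NE7bP1-G128-HANDOFF] NEXT (3)(c) (the Taylor structure of the next potential: its SECOND-order upper letter);
NOTHING of Bałaban's is named as a Lean object, valued or asserted; no `T4Continuum/Support` leaf typed; no `def`, no notation; zero `sorry`.
Imports (BY NAME): the OWNER's (313) `…SupEffectiveActionDerivative` (`hasFDerivAt_neg_log_step`, `fderiv_neg_log_step_apply`,
`integrable_weighted_cellDeriv`, `cellDeriv_apply`, `mul_opBound_le_of_le`), (314) `…SupOneSitePerturbation` (`tilted_mean_le_log_sub`),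
(306) (`measurable_cellSum`, `cellSum_eq_sum_biUnion`), (297) (`integrable_exp_neg`), (292) (`sum_add_sq_le`), (288)
(`integrable_exp_half_sq_on`); Mathlib's `HasFDerivAt.fderiv`, `ContinuousLinearMap.integral_apply`, `integral_mono`.

WHY (located).  (315) made the FIRST Taylor coefficient of the next potential small; the iteration also needs the SECOND-order control that
the road's class carries (`−λ ≤ u″ ≤ Λ` gives the remainder both a stability floor and an upper curvature).  The upper half passes through
ANY log-fluctuation-integral verbatim: `−log⟨e^{−G}⟩_ν ≤ ⟨G⟩_ν` with `G = V(ψ') − V(ψ)`, the pointwise letter under the tilted mean, and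
the linear term IS the derivative by (313).  (The lower half — a stability floor for the next potential — needs either convexity
(Brascamp–Lieb, the convex column (115)∕(116)) or the expansion's smallness, and is the successor's.)

WHAT IS PROVED ([folklore]; `μ = N(0,Γ)`, `Γ ⪰ 0`, `Γ ⪯ γ_op·1`; cells pairwise disjoint; `w_x ∈ C¹` with `w'_x` measurable, `|w'_x(t)| ≤ κ₁|t|`,
`−κ₀t² ≤ w_x(t) ≤ κ₀t²`, and the upper letter `w_x(b) ≤ w_x(a) + w'_x(a)(b−a) + ½Λ_w(b−a)²`; `0 < τ`, `0 < δ`, `0 < θ < 1`,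
`(2κ₀(1+τ)+4δ)γ_op ≤ θ`, `6κ₀(1+τ)γ_op ≤ θ`):
* §1 pointwise: `cellSum_upper_letter` (`V(ψ',ω) − V(ψ,ω) ≤ Σ_{p,x}w'_x(ω_x+ψ_x)(ψ'_x−ψ_x) + ½Λ_wΣ_{p,x}(ψ'_x−ψ_x)²`),
  `neg_two_sub_le` (`−(2V(ψ,ω) − V(ψ',ω)) ≤ 3κ₀(1+τ)Σ_Yω² + κ₀(1+τ⁻¹)Σ_Y(2ψ²+ψ'²)`);
* §2 integrability: `integrable_exp_neg_two_sub`, **`integrable_exp_neg_mul_sub`** (`e^{−V(ψ)}·(V(ψ)−V(ψ'))` is integrable: `|F| ≤ e^F + e^{−F}`);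
* §3 THE END **`neg_log_step_upper_letter`**:
  `−log Z(ψ') ≤ −log Z(ψ) + (fderiv ℝ (−log Z) ψ)(ψ'−ψ) + ½Λ_w·Σ_{p∈C}Σ_{x∈cell p}(ψ'_x−ψ_x)²`, at EVERY `ψ, ψ'`; §4 toy.

HONEST (what this is NOT).  The upper letter only (no lower∕stability letter for the next potential, no third-order remainder); scalar
skeleton ((A3), NC-NE7b-α UNRULED); nothing of Bałaban's asserted.  BY-NAME EFFECT ON THE WALL: NONE.  NE7b NOT PRINTED ∕ NOT PROVED; spine
PROVED 0∕9; rung (B)+1 — the programme's measures remain FINITE-torus statements; NOT the mass gap, NOT Clay.  HONEST DEPENDENCY: continuum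
YM on T⁴ ⇐ BetaPertH ∧ nine spine estimates (0∕9 proved); BetaPertH ⇐ (D1) ∧ (D4) ∧ CAP+tail; G-an2-4 gates asym, D1 and NE2∕3∕4.
-/

set_option autoImplicit false

noncomputable section

namespace Summit.QuantumFields.BalabanUV.T4Continuum.NE7b.SupEffectiveActionUpperLetter

open MeasureTheory ProbabilityTheory Finset Real
open scoped BigOperators
open SupEffectiveActionDerivative (hasFDerivAt_neg_log_step fderiv_neg_log_step_apply integrable_weighted_cellDeriv cellDeriv_apply
  mul_opBound_le_of_le)
open SupOneSitePerturbation (tilted_mean_le_log_sub)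
open SupSmallFieldGasReal (measurable_cellSum cellSum_eq_sum_biUnion)
open SupFluctuationAPriori (integrable_exp_neg)
open SupRegulatedActivityShift (sum_add_sq_le)
open SupGaussianRegulator (integrable_exp_half_sq_on)

variable {ι : Type} [Fintype ι] [DecidableEq ι] {V : Type*}

/-! ## §1. Pointwise -/

omit [Fintype ι] [DecidableEq ι] in
/-- **The pointwise upper letter summed over the cells**: `w_x(b) ≤ w_x(a) + w'_x(a)(b−a) + ½Λ_w(b−a)²` ⟹
`V(ψ',ω) − V(ψ,ω) ≤ Σ_{p∈C}Σ_{x∈cell p}w'_x(ω_x+ψ_x)(ψ'_x−ψ_x) + ½Λ_w·Σ_{p∈C}Σ_{x∈cell p}(ψ'_x−ψ_x)²`. [folklore] -/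
theorem cellSum_upper_letter (cell : V → Finset ι) {w w' : ι → ℝ → ℝ} {Λw : ℝ}
    (hwup : ∀ x (a b : ℝ), w x b ≤ w x a + w' x a * (b - a) + Λw / 2 * (b - a) ^ 2) (C : Finset V) (ω ψ ψ' : ι → ℝ) :
    ∑ p ∈ C, ∑ x ∈ cell p, w x (ω x + ψ' x) - ∑ p ∈ C, ∑ x ∈ cell p, w x (ω x + ψ x) ≤
      ∑ p ∈ C, ∑ x ∈ cell p, w' x (ω x + ψ x) * (ψ' x - ψ x) + Λw / 2 * ∑ p ∈ C, ∑ x ∈ cell p, (ψ' x - ψ x) ^ 2 := by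
  rw [← sum_sub_distrib, mul_sum, ← sum_add_distrib]
  refine sum_le_sum fun p _ => ?_
  rw [← sum_sub_distrib, mul_sum, ← sum_add_distrib]
  refine sum_le_sum fun x _ => ?_
  have h := hwup x (ω x + ψ x) (ω x + ψ' x)
  have he : ω x + ψ' x - (ω x + ψ x) = ψ' x - ψ x := by ring
  rw [he] at h
  linarith

omit [Fintype ι] [DecidableEq ι] in
/-- **Stability of `2V(ψ) − V(ψ')`**: `−κ₀t² ≤ w_x(t) ≤ κ₀t²` (`κ₀ ≥ 0`), `0 < τ` ⟹
`−(2Σ_{x∈Y}w_x(ω_x+ψ_x) − Σ_{x∈Y}w_x(ω_x+ψ'_x)) ≤ 3κ₀(1+τ)Σ_Yω_x² + κ₀(1+τ⁻¹)(2Σ_Yψ_x² + Σ_Yψ'_x²)`. [folklore] -/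
theorem neg_two_sub_le (Y : Finset ι) {w : ι → ℝ → ℝ} {κ₀ τ : ℝ} (hκ₀ : 0 ≤ κ₀) (hτ : 0 < τ)
    (hstab : ∀ x, ∀ t : ℝ, -(κ₀ * t ^ 2) ≤ w x t) (hquad : ∀ x, ∀ t : ℝ, w x t ≤ κ₀ * t ^ 2) (ω ψ ψ' : ι → ℝ) :
    -(2 * ∑ x ∈ Y, w x (ω x + ψ x) - ∑ x ∈ Y, w x (ω x + ψ' x)) ≤
      3 * κ₀ * (1 + τ) * ∑ x ∈ Y, ω x ^ 2 + κ₀ * (1 + τ⁻¹) * (2 * ∑ x ∈ Y, ψ x ^ 2 + ∑ x ∈ Y, ψ' x ^ 2) := by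
  have h1 : -(∑ x ∈ Y, w x (ω x + ψ x)) ≤ κ₀ * ∑ x ∈ Y, (ω x + ψ x) ^ 2 := by
    rw [mul_sum, ← sum_neg_distrib]
    exact sum_le_sum fun x _ => by linarith [hstab x (ω x + ψ x)]
  have h2 : ∑ x ∈ Y, w x (ω x + ψ' x) ≤ κ₀ * ∑ x ∈ Y, (ω x + ψ' x) ^ 2 := by
    rw [mul_sum]
    exact sum_le_sum fun x _ => hquad x (ω x + ψ' x)
  have hy1 := mul_le_mul_of_nonneg_left (sum_add_sq_le Y ω ψ hτ) hκ₀
  have hy2 := mul_le_mul_of_nonneg_left (sum_add_sq_le Y ω ψ' hτ) hκ₀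
  nlinarith

/-! ## §2. Integrability -/

section Integrability

variable {Γ : Matrix ι ι ℝ} {γop : ℝ} {cell : V → Finset ι} {w : ι → ℝ → ℝ} {κ₀ τ θ : ℝ}

/-- `e^{−(2V(ψ)−V(ψ'))}` is integrable under `N(0,Γ)` (`Γ ⪰ 0`, `Γ ⪯ γ_op·1`, `−κ₀t² ≤ w ≤ κ₀t²`, `6κ₀(1+τ)γ_op ≤ θ < 1`). [folklore] -/
theorem integrable_exp_neg_two_sub (hΓ : Γ.PosSemidef) (hΓop : (γop • (1 : Matrix ι ι ℝ) - Γ).PosSemidef)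
    (hdisj : ∀ p q, p ≠ q → Disjoint (cell p) (cell q)) (hw : ∀ x, Measurable (w x)) (hκ₀ : 0 ≤ κ₀) (hτ : 0 < τ) (hθ1 : θ < 1)
    (hκθ : 6 * κ₀ * (1 + τ) * γop ≤ θ) (hstab : ∀ x, ∀ t : ℝ, -(κ₀ * t ^ 2) ≤ w x t) (hquad : ∀ x, ∀ t : ℝ, w x t ≤ κ₀ * t ^ 2)
    (C : Finset V) (ψ ψ' : EuclideanSpace ℝ ι) :
    Integrable (fun ω : EuclideanSpace ℝ ι => exp (-(2 * ∑ p ∈ C, ∑ x ∈ cell p, w x (ω x + ψ x) -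
      ∑ p ∈ C, ∑ x ∈ cell p, w x (ω x + ψ' x)))) (multivariateGaussian 0 Γ) := by
  set Y := C.biUnion cell with hY
  have hκ' : 0 ≤ 6 * κ₀ * (1 + τ) := by positivity
  have hint := integrable_exp_half_sq_on hΓ hΓop hκ' hθ1 hκθ Y
  have hmeas : Measurable fun ω : EuclideanSpace ℝ ι => exp (-(2 * ∑ p ∈ C, ∑ x ∈ cell p, w x (ω x + ψ x) -
      ∑ p ∈ C, ∑ x ∈ cell p, w x (ω x + ψ' x))) :=
    measurable_exp.comp (((measurable_cellSum cell w hw C (fun x => ψ x)).const_mul 2).sub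
      (measurable_cellSum cell w hw C (fun x => ψ' x))).neg
  refine (hint.const_mul (exp (κ₀ * (1 + τ⁻¹) * (2 * ∑ x ∈ Y, ψ x ^ 2 + ∑ x ∈ Y, ψ' x ^ 2)))).mono' hmeas.aestronglyMeasurable
    (ae_of_all _ fun ω => ?_)
  rw [Real.norm_of_nonneg (exp_pos _).le, ← exp_add]
  refine exp_le_exp.2 ?_
  rw [cellSum_eq_sum_biUnion cell hdisj C, cellSum_eq_sum_biUnion cell hdisj C]
  have h := neg_two_sub_le Y hκ₀ hτ hstab hquad (fun x => ω x) (fun x => ψ x) (fun x => ψ' x)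
  have heq : 6 * κ₀ * (1 + τ) * (∑ x ∈ Y, ω x ^ 2) / 2 = 3 * κ₀ * (1 + τ) * ∑ x ∈ Y, ω x ^ 2 := by ring
  linarith

/-- **`e^{−V(ψ)}·(V(ψ) − V(ψ'))` IS INTEGRABLE** (`|F| ≤ e^{F} + e^{−F}`: dominated by `e^{−V(ψ')} + e^{−(2V(ψ)−V(ψ'))}`). [folklore] -/
theorem integrable_exp_neg_mul_sub (hΓ : Γ.PosSemidef) (hΓop : (γop • (1 : Matrix ι ι ℝ) - Γ).PosSemidef)
    (hdisj : ∀ p q, p ≠ q → Disjoint (cell p) (cell q)) (hw : ∀ x, Measurable (w x)) (hκ₀ : 0 ≤ κ₀) (hτ : 0 < τ) (hθ0 : 0 < θ)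
    (hθ1 : θ < 1) (hκθ : 6 * κ₀ * (1 + τ) * γop ≤ θ) (hstab : ∀ x, ∀ t : ℝ, -(κ₀ * t ^ 2) ≤ w x t)
    (hquad : ∀ x, ∀ t : ℝ, w x t ≤ κ₀ * t ^ 2) (C : Finset V) (ψ ψ' : EuclideanSpace ℝ ι) :
    Integrable (fun ω : EuclideanSpace ℝ ι => exp (-(∑ p ∈ C, ∑ x ∈ cell p, w x (ω x + ψ x))) *
      (∑ p ∈ C, ∑ x ∈ cell p, w x (ω x + ψ x) - ∑ p ∈ C, ∑ x ∈ cell p, w x (ω x + ψ' x))) (multivariateGaussian 0 Γ) := by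
  have hκθ₁ : 2 * κ₀ * (1 + τ) * γop ≤ θ := mul_opBound_le_of_le (by positivity) (by nlinarith) hθ0.le hκθ
  have h1 : Integrable (fun ω : EuclideanSpace ℝ ι => exp (-(∑ p ∈ C, ∑ x ∈ cell p, w x (ω x + ψ' x)))) (multivariateGaussian 0 Γ) := by
    have h := integrable_exp_neg hΓ hΓop (C.biUnion cell) w hw hκ₀ hτ hθ1 hκθ₁ hstab (fun x => ψ' x)
    refine h.congr (ae_of_all _ fun ω => ?_)
    simp only
    rw [cellSum_eq_sum_biUnion cell hdisj C]
  have h2 := integrable_exp_neg_two_sub hΓ hΓop hdisj hw hκ₀ hτ hθ1 hκθ hstab hquad C ψ ψ'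
  have hmeas : Measurable fun ω : EuclideanSpace ℝ ι => exp (-(∑ p ∈ C, ∑ x ∈ cell p, w x (ω x + ψ x))) *
      (∑ p ∈ C, ∑ x ∈ cell p, w x (ω x + ψ x) - ∑ p ∈ C, ∑ x ∈ cell p, w x (ω x + ψ' x)) :=
    (measurable_exp.comp (measurable_cellSum cell w hw C (fun x => ψ x)).neg).mul
      ((measurable_cellSum cell w hw C (fun x => ψ x)).sub (measurable_cellSum cell w hw C (fun x => ψ' x)))
  refine (h1.add h2).mono' hmeas.aestronglyMeasurable (ae_of_all _ fun ω => ?_)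
  set A : ℝ := ∑ p ∈ C, ∑ x ∈ cell p, w x (ω x + ψ x) with hA
  set B : ℝ := ∑ p ∈ C, ∑ x ∈ cell p, w x (ω x + ψ' x) with hB
  rw [norm_mul, Real.norm_of_nonneg (exp_pos _).le, Real.norm_eq_abs]
  have hb : |A - B| ≤ exp (A - B) + exp (-(A - B)) := by
    rcases le_or_gt 0 (A - B) with h0 | h0
    · rw [abs_of_nonneg h0]; linarith [add_one_le_exp (A - B), exp_pos (-(A - B))]
    · rw [abs_of_neg h0]; linarith [add_one_le_exp (-(A - B)), exp_pos (A - B)]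
  calc exp (-A) * |A - B| ≤ exp (-A) * (exp (A - B) + exp (-(A - B))) := mul_le_mul_of_nonneg_left hb (exp_pos _).le
    _ = exp (-B) + exp (-(2 * A - B)) := by
        rw [mul_add, ← exp_add, ← exp_add]
        congr 1 <;> congr 1 <;> ring

end Integrability

/-! ## §3. THE END: the upper letter of the next potential -/

/-- **THE END — THE UPPER SECOND-ORDER LETTER IS INHERITED BY THE STEP, WITH THE SAME CONSTANT.**  `Γ ⪰ 0`, `Γ ⪯ γ_op·1`; pairwise
disjoint cells; `w_x ∈ C¹` with `w'_x` measurable, `|w'_x(t)| ≤ κ₁|t|` (`κ₁ ≥ 0`), `−κ₀t² ≤ w_x(t) ≤ κ₀t²` (`κ₀ ≥ 0`) and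
`w_x(b) ≤ w_x(a) + w'_x(a)(b−a) + ½Λ_w(b−a)²`; `0 < τ`, `0 < δ`, `0 < θ < 1`, `(2κ₀(1+τ)+4δ)γ_op ≤ θ`, `6κ₀(1+τ)γ_op ≤ θ` ⟹ for ALL `ψ, ψ'`:
`−log Z(ψ') ≤ −log Z(ψ) + (fderiv ℝ (−log Z) ψ)(ψ'−ψ) + ½Λ_w·Σ_{p∈C}Σ_{x∈cell p}(ψ'_x−ψ_x)²`, `Z(ψ) = ∫e^{−Σ_{p∈C}Σ_{x∈cell p}w_x(ω_x+ψ_x)}dN(0,Γ)`.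
[folklore] -/
theorem neg_log_step_upper_letter {Γ : Matrix ι ι ℝ} {γop : ℝ} {cell : V → Finset ι} {w w' : ι → ℝ → ℝ} {κ₀ κ₁ Λw τ δ θ : ℝ}
    (hΓ : Γ.PosSemidef) (hΓop : (γop • (1 : Matrix ι ι ℝ) - Γ).PosSemidef) (hdisj : ∀ p q, p ≠ q → Disjoint (cell p) (cell q))
    (hw' : ∀ x t, HasDerivAt (w x) (w' x t) t) (hw'm : ∀ x, Measurable (w' x)) (hκ₀ : 0 ≤ κ₀) (hκ₁ : 0 ≤ κ₁) (hτ : 0 < τ)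
    (hδ : 0 < δ) (hθ0 : 0 < θ) (hθ1 : θ < 1) (hκθ : (2 * κ₀ * (1 + τ) + 4 * δ) * γop ≤ θ) (hκθ₆ : 6 * κ₀ * (1 + τ) * γop ≤ θ)
    (hstab : ∀ x, ∀ t : ℝ, -(κ₀ * t ^ 2) ≤ w x t) (hquad : ∀ x, ∀ t : ℝ, w x t ≤ κ₀ * t ^ 2) (hw'b : ∀ x t, |w' x t| ≤ κ₁ * |t|)
    (hwup : ∀ x (a b : ℝ), w x b ≤ w x a + w' x a * (b - a) + Λw / 2 * (b - a) ^ 2) (C : Finset V) (ψ ψ' : EuclideanSpace ℝ ι) :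
    -log (∫ ω : EuclideanSpace ℝ ι, exp (-(∑ p ∈ C, ∑ x ∈ cell p, w x (ω x + ψ' x))) ∂(multivariateGaussian 0 Γ)) ≤
      -log (∫ ω : EuclideanSpace ℝ ι, exp (-(∑ p ∈ C, ∑ x ∈ cell p, w x (ω x + ψ x))) ∂(multivariateGaussian 0 Γ)) +
        fderiv ℝ (fun φ : EuclideanSpace ℝ ι =>
          -log (∫ ω : EuclideanSpace ℝ ι, exp (-(∑ p ∈ C, ∑ x ∈ cell p, w x (ω x + φ x))) ∂(multivariateGaussian 0 Γ))) ψ (ψ' - ψ) +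
        Λw / 2 * ∑ p ∈ C, ∑ x ∈ cell p, (ψ' x - ψ x) ^ 2 := by
  set μ := multivariateGaussian 0 Γ with hμ
  have hw : ∀ x, Measurable (w x) := fun x => (continuous_iff_continuousAt.2 fun t => (hw' x t).continuousAt).measurable
  have hκθ₁ : 2 * κ₀ * (1 + τ) * γop ≤ θ := mul_opBound_le_of_le (by positivity) (by nlinarith) hθ0.le hκθ₆
  -- integrability letters
  have hU : Integrable (fun ω : EuclideanSpace ℝ ι => exp (-(∑ p ∈ C, ∑ x ∈ cell p, w x (ω x + ψ x)))) μ := by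
    have h := integrable_exp_neg hΓ hΓop (C.biUnion cell) w hw hκ₀ hτ hθ1 hκθ₁ hstab (fun x => ψ x)
    refine h.congr (ae_of_all _ fun ω => ?_)
    simp only
    rw [cellSum_eq_sum_biUnion cell hdisj C]
  have hUF := integrable_exp_neg_mul_sub hΓ hΓop hdisj hw hκ₀ hτ hθ0 hθ1 hκθ₆ hstab hquad C ψ ψ'
  have hF : Integrable (fun ω : EuclideanSpace ℝ ι => exp (-(∑ p ∈ C, ∑ x ∈ cell p, w x (ω x + ψ x)) +
      (∑ p ∈ C, ∑ x ∈ cell p, w x (ω x + ψ x) - ∑ p ∈ C, ∑ x ∈ cell p, w x (ω x + ψ' x)))) μ := by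
    have h := integrable_exp_neg hΓ hΓop (C.biUnion cell) w hw hκ₀ hτ hθ1 hκθ₁ hstab (fun x => ψ' x)
    refine h.congr (ae_of_all _ fun ω => ?_)
    simp only
    rw [← cellSum_eq_sum_biUnion cell hdisj C]
    congr 1
    ring
  have hZ : 0 < ∫ ω : EuclideanSpace ℝ ι, exp (-(∑ p ∈ C, ∑ x ∈ cell p, w x (ω x + ψ x))) ∂μ := integral_exp_pos hU
  -- Gibbs: `⟨V(ψ) − V(ψ')⟩ ≤ log Z(ψ') − log Z(ψ)`
  have hG := tilted_mean_le_log_sub hU hUF hF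
  have hZ' : ∫ ω : EuclideanSpace ℝ ι, exp (-(∑ p ∈ C, ∑ x ∈ cell p, w x (ω x + ψ x)) +
      (∑ p ∈ C, ∑ x ∈ cell p, w x (ω x + ψ x) - ∑ p ∈ C, ∑ x ∈ cell p, w x (ω x + ψ' x))) ∂μ =
      ∫ ω : EuclideanSpace ℝ ι, exp (-(∑ p ∈ C, ∑ x ∈ cell p, w x (ω x + ψ' x))) ∂μ :=
    integral_congr_ae (ae_of_all _ fun ω => by dsimp only; congr 1; ring)
  rw [hZ'] at hG
  -- the tilted mean of `V(ψ') − V(ψ)` is at most the derivative term plus the quadratic term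
  have hderiv_int := integrable_weighted_cellDeriv hΓ hΓop hdisj hw' hw'm hκ₀ hκ₁ hτ hδ hθ1 hκθ hstab hw'b C ψ
  have hlin : Integrable (fun ω : EuclideanSpace ℝ ι => exp (-(∑ p ∈ C, ∑ x ∈ cell p, w x (ω x + ψ x))) *
      (∑ p ∈ C, ∑ x ∈ cell p, w' x (ω x + ψ x) * (ψ' x - ψ x))) μ := by
    have h := (ContinuousLinearMap.apply ℝ ℝ (ψ' - ψ)).integrable_comp hderiv_int
    refine h.congr (ae_of_all _ fun ω => ?_)
    simp only [ContinuousLinearMap.apply_apply, _root_.smul_apply, smul_eq_mul, cellDeriv_apply, WithLp.ofLp_sub, Pi.sub_apply]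
  have hmono : ∫ ω : EuclideanSpace ℝ ι, exp (-(∑ p ∈ C, ∑ x ∈ cell p, w x (ω x + ψ x))) *
      -(∑ p ∈ C, ∑ x ∈ cell p, w x (ω x + ψ x) - ∑ p ∈ C, ∑ x ∈ cell p, w x (ω x + ψ' x)) ∂μ ≤
      ∫ ω : EuclideanSpace ℝ ι, (exp (-(∑ p ∈ C, ∑ x ∈ cell p, w x (ω x + ψ x))) *
        (∑ p ∈ C, ∑ x ∈ cell p, w' x (ω x + ψ x) * (ψ' x - ψ x)) +
        (Λw / 2 * ∑ p ∈ C, ∑ x ∈ cell p, (ψ' x - ψ x) ^ 2) * exp (-(∑ p ∈ C, ∑ x ∈ cell p, w x (ω x + ψ x)))) ∂μ := by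
    refine integral_mono ?_ (hlin.add (hU.const_mul _)) fun ω => ?_
    · refine hUF.neg.congr (ae_of_all _ fun ω => ?_)
      simp only [Pi.neg_apply, mul_neg]
    · have h := cellSum_upper_letter cell hwup C (fun x => ω x) (fun x => ψ x) (fun x => ψ' x)
      have he : 0 < exp (-(∑ p ∈ C, ∑ x ∈ cell p, w x (ω x + ψ x))) := exp_pos _
      nlinarith
  rw [integral_add hlin (hU.const_mul _), integral_const_mul] at hmono
  have hneg : ∫ ω : EuclideanSpace ℝ ι, exp (-(∑ p ∈ C, ∑ x ∈ cell p, w x (ω x + ψ x))) *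
      -(∑ p ∈ C, ∑ x ∈ cell p, w x (ω x + ψ x) - ∑ p ∈ C, ∑ x ∈ cell p, w x (ω x + ψ' x)) ∂μ =
      -∫ ω : EuclideanSpace ℝ ι, exp (-(∑ p ∈ C, ∑ x ∈ cell p, w x (ω x + ψ x))) *
        (∑ p ∈ C, ∑ x ∈ cell p, w x (ω x + ψ x) - ∑ p ∈ C, ∑ x ∈ cell p, w x (ω x + ψ' x)) ∂μ := by
    rw [← integral_neg]
    exact integral_congr_ae (ae_of_all _ fun ω => by simp only [mul_neg])
  rw [hneg] at hmono
  -- the derivative term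
  rw [(hasFDerivAt_neg_log_step hΓ hΓop hdisj hw' hw'm hκ₀ hκ₁ hτ hδ hθ0 hθ1 hκθ hstab hw'b C ψ).fderiv,
    fderiv_neg_log_step_apply hΓ hΓop hdisj hw' hw'm hκ₀ hκ₁ hτ hδ hθ1 hκθ hstab hw'b C ψ (ψ' - ψ)]
  have hsub : ∀ ω : EuclideanSpace ℝ ι, ∑ p ∈ C, ∑ x ∈ cell p, w' x (ω x + ψ x) * (ψ' - ψ) x =
      ∑ p ∈ C, ∑ x ∈ cell p, w' x (ω x + ψ x) * (ψ' x - ψ x) :=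
    fun ω => sum_congr rfl fun p _ => sum_congr rfl fun x _ => by simp only [WithLp.ofLp_sub, Pi.sub_apply]
  simp_rw [hsub]
  -- divide the mean inequality by `Z > 0` and combine with Gibbs
  have hdiv := div_le_div_of_nonneg_right hmono hZ.le
  rw [add_div, mul_div_assoc, div_self hZ.ne', mul_one, neg_div] at hdiv
  rw [inv_mul_eq_div]
  linarith

/-! ## §4. Toy -/

/-- Toy (§1): the ZERO remainder has the upper letter with `Λ_w = 0`, and the summed letter reads `0 ≤ 0`. -/
example (cell : Unit → Finset (Fin 1)) (ω ψ ψ' : Fin 1 → ℝ) :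
    ∑ p ∈ ({()} : Finset Unit), ∑ x ∈ cell p, (fun (_ : Fin 1) (_ : ℝ) => (0 : ℝ)) x (ω x + ψ' x) -
        ∑ p ∈ ({()} : Finset Unit), ∑ x ∈ cell p, (fun (_ : Fin 1) (_ : ℝ) => (0 : ℝ)) x (ω x + ψ x) ≤
      ∑ p ∈ ({()} : Finset Unit), ∑ x ∈ cell p, (fun (_ : Fin 1) (_ : ℝ) => (0 : ℝ)) x (ω x + ψ x) * (ψ' x - ψ x) +
        (0 : ℝ) / 2 * ∑ p ∈ ({()} : Finset Unit), ∑ x ∈ cell p, (ψ' x - ψ x) ^ 2 :=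
  cellSum_upper_letter cell (w := fun _ _ => 0) (w' := fun _ _ => 0) (fun x a b => by simp) {()} ω ψ ψ'

end Summit.QuantumFields.BalabanUV.T4Continuum.NE7b.SupEffectiveActionUpperLetter
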